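import Summits.CriticalPhenomena.PercolationContinuityZ3.Theorems.PercNearOneGluingNoHeavyLowerTailQ44ComplementaryPacking
import HarnessLib
import HarnessLib.Audit.Tags

/-!
# The row `V`: a second facet of the four-point type-count cone, `c₀c₁₄ ≥ e₂(pairings) + ½·(all pairing–pair products) + ½·(darts avoiding one terminal)`

Support file for crux `stmt-CriticalPhenomena-4575` (master-family programme; packing `U` / Conjecture W line), seat `prim-l12-p6` gen 31; memo
`run/shared/lean/prim/prim-l12/FROM-prim-l12-p6-g31-PRIMED-FAMILY.md` §10.  Cells as in `FourPointAtoms.pat4` (`0 ⊥, 1 cy, 2 by, 3 bc, 4 ay, 5 ac,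
6 ab, 7 bcy, 8 ay|bc, 9 ac|by, 10 acy, 11 ab|cy, 12 aby, 13 abc, 14 abcy`).

FINDING of the memo: the polytope of `B_4`-valid weight vectors `w` on the 27 complementary antipodal pair types (rows `2·N(⊤;⊥) ≥ Σ w_t N_t`) has
(at least) 154 orbits of maximal points; all 288 half-integral orbit representatives are valid on every monotone map of `B_5` (SAT, kit j236969) and on every
graph fibre tested.  The maximum of `Σ w_t` is attained by ONE `Sym`-orbit of size 4 (choice of a terminal `t`), the row
  `V_t := c₀c₁₄ − (c₈c₉ + c₈c₁₁ + c₉c₁₁) − ½·Σ_{π} Σ_{s crossing π} c_π c_s − ½·Σ_{s ⊆ T∖t} Σ_{u ∈ s} c_s c_{T∖u} ≥ 0`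
(all twelve (pairing ; crossing pair) products at weight ½; the six darts of the three pairs avoiding `t`, each against the two three-blocks through exactly one of
its ends — both of which contain `t`).  Evidence for `V_y`: all monotone maps of `B_2…B_5`, all atomic maps of `B_6` (kissat, kit j236992), 84/85 cubes of `B_6`
mono, every simple-graph fibre with `nv ≤ 6` and `nv = 7, m ≤ 11` (1 307 724), 23 000 random multigraph fibres (`nv ≤ 9, m ≤ 18`), 250 exact multi-scale laws.
`V` is NOT a member of the primed family `Θ(π,π′)` of `…Q44PrimedKernels` (it charges all three hub pairings at half weight instead of one at full weight).

* `TwoCopyMono.vE2`, `vPS`, `vDy` — the type sets; `TwoCopyMono.kerV` — the integer kernel of `4·V_y`;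
* `TwoCopyMono.sum_kerV_cell` — evaluation; `TwoCopyMono.rowV_of_goodKernel` — the law-level reduction `GoodKernel kerV → V_y ≥ 0` on every finite weighted
  graph, all `n` (via `sum_kernel_cell_nonneg`);
* `TwoCopyMono.ConjV` (`@[conjecture]`, OPEN) — the fibre statement `GoodKernel kerV`.
No sorries, no named facts; standard axioms.
-/

namespace Summit.CriticalPhenomena.PercolationContinuityZ3.Theorems

namespace TwoCopyMono

open Finset FourPointAtoms

/-- The three pairing–pairing types, both orientations (`e₂(c₈,c₉,c₁₁)` twice). [this work] -/
def vE2 : Finset (Fin 15 × Fin 15) := {(11, 9), (11, 8), (9, 11), (9, 8), (8, 11), (8, 9)}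

/-- The twelve (pairing ; crossing pair) types, one orientation each (pairing first). [this work] -/
def vPS : Finset (Fin 15 × Fin 15) := {(11, 5), (11, 4), (11, 3), (11, 2), (9, 6), (9, 4), (9, 3), (9, 1), (8, 6), (8, 5), (8, 2), (8, 1)}

/-- The six darts of the pairs avoiding `y` (`ab, ac, bc`, each against the two three-blocks through exactly one of its ends), one orientation. [this work] -/
def vDy : Finset (Fin 15 × Fin 15) := {(6, 10), (6, 7), (5, 12), (5, 7), (3, 12), (3, 10)}

/-- **The integer kernel of `4·V_y`**: `2·[uTop] − [vE2] − [vPS] − [vDy]`. [this work] -/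
def kerV (i j : Fin 15) : ℤ := 2 * indK uTop i j - indK vE2 i j - indK vPS i j - indK vDy i j

/-- Evaluation of the `V_y` kernel form: `Σ κᵢⱼ cᵢ cⱼ = 4c₀c₁₄ − 2e₂(c₈,c₉,c₁₁) − Σ_(π;s) c_π c_s − Σ_(darts avoiding y) c_s c_β = 4·V_y(c)`. [this work] -/
theorem sum_kerV_cell (c : Fin 15 → ℝ) :
    (∑ i : Fin 15, ∑ j : Fin 15, (kerV i j : ℝ) * c i * c j) =
      4 * (c 0 * c 14) - 2 * (c 8 * c 9 + c 8 * c 11 + c 9 * c 11) -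
        (c 11 * c 5 + c 11 * c 4 + c 11 * c 3 + c 11 * c 2 + c 9 * c 6 + c 9 * c 4 + c 9 * c 3 + c 9 * c 1 + c 8 * c 6 + c 8 * c 5 + c 8 * c 2 + c 8 * c 1) -
          (c 6 * c 10 + c 6 * c 7 + c 5 * c 12 + c 5 * c 7 + c 3 * c 12 + c 3 * c 10) := by
  have hsplit : ∀ i j : Fin 15, (kerV i j : ℝ) * c i * c j =
      2 * ((indK uTop i j : ℝ) * c i * c j) - (indK vE2 i j : ℝ) * c i * c j - (indK vPS i j : ℝ) * c i * c j -
        (indK vDy i j : ℝ) * c i * c j := by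
    intro i j; unfold kerV; push_cast; ring
  simp_rw [hsplit, Finset.sum_sub_distrib, ← Finset.mul_sum]
  rw [sum_indK_cell, sum_indK_cell, sum_indK_cell, sum_indK_cell]
  have hT : (∑ p ∈ uTop, c p.1 * c p.2) = 2 * (c 0 * c 14) := by
    unfold uTop; rw [Finset.sum_insert (by decide), Finset.sum_singleton]; ring
  have hE : (∑ p ∈ vE2, c p.1 * c p.2) = 2 * (c 8 * c 9 + c 8 * c 11 + c 9 * c 11) := by
    unfold vE2; rw [Finset.sum_insert (by decide), Finset.sum_insert (by decide), Finset.sum_insert (by decide), Finset.sum_insert (by decide), Finset.sum_insert (by decide), Finset.sum_singleton]; ring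
  have hP : (∑ p ∈ vPS, c p.1 * c p.2) = c 11 * c 5 + c 11 * c 4 + c 11 * c 3 + c 11 * c 2 + c 9 * c 6 + c 9 * c 4 + c 9 * c 3 + c 9 * c 1 + c 8 * c 6 + c 8 * c 5 + c 8 * c 2 + c 8 * c 1 := by
    unfold vPS; rw [Finset.sum_insert (by decide), Finset.sum_insert (by decide), Finset.sum_insert (by decide), Finset.sum_insert (by decide), Finset.sum_insert (by decide), Finset.sum_insert (by decide), Finset.sum_insert (by decide), Finset.sum_insert (by decide), Finset.sum_insert (by decide), Finset.sum_insert (by decide), Finset.sum_insert (by decide), Finset.sum_singleton]; ring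
  have hD : (∑ p ∈ vDy, c p.1 * c p.2) = c 6 * c 10 + c 6 * c 7 + c 5 * c 12 + c 5 * c 7 + c 3 * c 12 + c 3 * c 10 := by
    unfold vDy; rw [Finset.sum_insert (by decide), Finset.sum_insert (by decide), Finset.sum_insert (by decide), Finset.sum_insert (by decide), Finset.sum_insert (by decide), Finset.sum_singleton]; ring
  rw [hT, hE, hP, hD]; ring

variable {n : ℕ}

/-- **`V_y ≥ 0` for all `n` from its kernel (the reduction).**  If `kerV` is a good kernel, then on every finite weighted graph and for all marked points,
`2e₂(c₈,c₉,c₁₁) + Σ_(π;s crossing π) c_π c_s + Σ_(darts of ab, ac, bc) c_s c_β ≤ 4 c₀ c₁₄`. [this work] -/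
theorem rowV_of_goodKernel (hK : GoodKernel kerV) (w : Sym2 (Fin n) → unitInterval) (a b c y : Fin n) :
    2 * (cell w a b c y 8 * cell w a b c y 9 + cell w a b c y 8 * cell w a b c y 11 + cell w a b c y 9 * cell w a b c y 11) +
      (cell w a b c y 11 * cell w a b c y 5 + cell w a b c y 11 * cell w a b c y 4 + cell w a b c y 11 * cell w a b c y 3 + cell w a b c y 11 * cell w a b c y 2 + cell w a b c y 9 * cell w a b c y 6 + cell w a b c y 9 * cell w a b c y 4 + cell w a b c y 9 * cell w a b c y 3 + cell w a b c y 9 * cell w a b c y 1 + cell w a b c y 8 * cell w a b c y 6 + cell w a b c y 8 * cell w a b c y 5 + cell w a b c y 8 * cell w a b c y 2 + cell w a b c y 8 * cell w a b c y 1) +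
      (cell w a b c y 6 * cell w a b c y 10 + cell w a b c y 6 * cell w a b c y 7 + cell w a b c y 5 * cell w a b c y 12 +
        cell w a b c y 5 * cell w a b c y 7 + cell w a b c y 3 * cell w a b c y 12 + cell w a b c y 3 * cell w a b c y 10) ≤
      4 * (cell w a b c y 0 * cell w a b c y 14) := by
  have h := sum_kernel_cell_nonneg hK w a b c y
  rw [sum_kerV_cell] at h
  linarith

/-- **CONJECTURE V (fibre form)**: `kerV` is a good kernel, i.e. along every monotone cell map
`2·#{two distinct pairings} + #{(pairing ; crossing pair)} + #{darts of the pairs avoiding y} ≤ 2·#{top goods}` (ordered point counts).  OPEN; evidence in the file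
header; independent of (neither implies nor is implied by, at `B_4`) the primed rows `U′`, `W′`, `S3′`. [this work] -/
@[conjecture] def ConjV : Prop := GoodKernel kerV

end TwoCopyMono

end Summit.CriticalPhenomena.PercolationContinuityZ3.Theorems
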